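import Summits.Ventures.CertifiedArithmetic.Expansions.CompressLocality
import Summits.Ventures.CertifiedArithmetic.Expansions.CompressScaling
import Summits.Ventures.CertifiedArithmetic.Expansions.CompressWindow
import Mathlib.Tactic.Linarith
import Mathlib.Tactic.Positivity
import Mathlib.Tactic.Ring
import Mathlib.Tactic.NormNum

/-!
# The kink family: one COMPRESS pass moves the kink one block down (new work)

New work of the certified-arithmetic venture (ENGINES group: shared numerical engines serving
client cells; rigour lives in the verifiers; every published number belongs to a client cell's
ledger, not to the engines group).  NOT a published theorem: Shewchuk [Shewchuk1997, §2.7] proves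
Theorem 23 about ONE pass of COMPRESS and says nothing about iterating it; the tree knows inputs
needing two passes at every precision (`CompressNotIdempotent.lean`) and three at `p = 2`
(`CompressThreePasses.lean`).  Here: **the number of passes COMPRESS needs to reach its fixed point
is unbounded** — at precision `p = 3` with IEEE ties-to-even (`roundTiesEven 3 emin`, `emin ≤ 0`),
for every `k` the nonoverlapping expansion of `2k + 4` three-bit floats
`fam3 k = ⟨5, −3·2^5⟩ ++ ⟨5, −3·2^5⟩·2^9 ++ ⋯ ++ ⟨5, −3·2^5⟩·2^(9(k−1))`
`  ++ ⟨−3, −3·2^3, 7·2^6, −5·2^12⟩·2^(9k)`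
(smallest first: `k` PAIR BLOCKS, then the KINK and the summit) changes under each of the first
`k + 1` passes of COMPRESS and is fixed from then on (the count itself is drawn in
`CompressPassesUnbounded.lean`; this file is the engine).

Mechanism (`compress_state3_succ`): by locality (`CompressLocality.lean`) a pass acts only on the
window formed by the top pair block and the kink, and by scale covariance (`CompressScaling.lean`)
that action is the certified `p = 3` computation of `CompressWindow.lean`: the kink moves ONE
BLOCK DOWN, leaving inert debris `⟨−7·2^11, 7·2^15⟩` behind; everything else is an inert chain
(pair blocks below, debris and summit above).  After `k` passes the kink sits at the bottom
(`state3 0 k`), pass `k + 1` turns `⟨−3, −3·2^3, 7·2^6⟩` into `⟨1, −7·2^2, 7·2^6⟩` (`final3 k`),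
which is a chain, hence fixed.  So `passes(fam3 k) = k + 1 = n/2 − 1` for `n = 2k + 4` components:
no bound on the number of COMPRESS passes holds uniformly in the length of the expansion.
-/

namespace Summit.Ventures.CertifiedArithmetic.Expansions

open Literature.ComputerArithmetic.JeannerodRump2018
open Literature.ComputerArithmetic.BoldoJeannerodMelquiondMuller2023 hiding twoSum twoSum_fst
open Literature.ComputerArithmetic.Shewchuk1997

variable {emin : ℤ}

/-! ### The family -/

/-- A list of small integers read in the binade `2^s`. -/
def sc (s : ℤ) (l : List ℚ) : List ℚ := l.map (· * (2 : ℚ) ^ s)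

/-- `m` pair blocks `⟨5, −3·2^5⟩·2^(9j)`, `j < m`, smallest first. -/
def pairs3 : ℕ → List ℚ
  | 0 => []
  | m + 1 => pairs3 m ++ sc (9 * m) [5, -96]

/-- The kink `⟨−3, −3·2^3, 7·2^6⟩·2^s`. -/
def kink3 (s : ℤ) : List ℚ := sc s [-3, -24, 448]

/-- `n` debris blocks `⟨−7·2^11, 7·2^15⟩·2^s, ·2^(s+9), …`. -/
def debris3 : ℤ → ℕ → List ℚ
  | _, 0 => []
  | s, n + 1 => sc s [-14336, 229376] ++ debris3 (s + 9) n

/-- The state with `m` pair blocks below the kink and `n` debris blocks above it, under the summit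
`−5·2^12·2^(9(m+n))`. -/
def state3 (m n : ℕ) : List ℚ :=
  pairs3 m ++ (kink3 (9 * m) ++ (debris3 (9 * m) n ++ [-20480 * (2 : ℚ) ^ (9 * (m + n) : ℤ)]))

/-- THE FAMILY: `k` pair blocks, the kink, the summit — `2k + 4` components. -/
def fam3 (k : ℕ) : List ℚ := state3 k 0

/-- The fixed point reached after `k + 1` passes. -/
def final3 (n : ℕ) : List ℚ :=
  [1, -28, 448] ++ (debris3 0 n ++ [-20480 * (2 : ℚ) ^ (9 * n : ℤ)])

/-- Reading the empty list in a binade gives the empty list. [cite: BoldoEtAl2023, §2.1] -/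
@[simp] theorem sc_nil (s : ℤ) : sc s [] = [] := rfl
/-- `sc` scales the head and the tail. [cite: BoldoEtAl2023, §2.1] -/
@[simp] theorem sc_cons (s : ℤ) (a : ℚ) (l : List ℚ) : sc s (a :: l) = a * 2 ^ s :: sc s l := rfl

/-- Exponent bookkeeping: `c·2^(s+j) = (c·2^j)·2^s`. [cite: BoldoEtAl2023, §2.1] -/
theorem sc_shift (c : ℚ) (s : ℤ) (j : ℕ) : c * (2 : ℚ) ^ (s + j) = (c * 2 ^ j) * 2 ^ s := by
  rw [zpow_add₀ (by norm_num : (2 : ℚ) ≠ 0), zpow_natCast]; ring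

/-- `m` pair blocks have `2m` components. [cite: Shewchuk1997, §2.1 (expansion)] -/
theorem length_pairs3 : ∀ m : ℕ, (pairs3 m).length = 2 * m
  | 0 => rfl
  | m + 1 => by rw [pairs3, List.length_append, length_pairs3 m]; simp [sc]; ring

/-- `fam3 k` has `2k + 4` components. -/
theorem length_fam3 (k : ℕ) : (fam3 k).length = 2 * k + 4 := by
  simp [fam3, state3, kink3, debris3, sc, length_pairs3]

/-! ### Roundings and floats in the binade `2^s` -/

section rounding
variable (he : emin ≤ 0)
include he

/-- A base rounding `RN_e^{3,em}(a) = r` (all `em ≤ 0`) read in the binade `2^s`, `s ≥ 0`.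
[cite: BoldoEtAl2023, §2.2] -/
theorem rn3_sc {s : ℤ} (hs : 0 ≤ s) {a r : ℚ} (h : ∀ em : ℤ, em ≤ 0 → roundTiesEven 3 em a = r) :
    roundTiesEven 3 emin (a * 2 ^ s) = r * 2 ^ s := by
  rw [roundTiesEven_mul_two_zpow, h _ (by linarith)]

/-- `M·2^j·2^s` with `|M| < 8` is a 3-bit float (`s ≥ 0 ≥ emin`). [cite: JeannerodRump2018, §1] -/
theorem isFloat3_sc {s : ℤ} (hs : 0 ≤ s) {c : ℚ} (M : ℤ) (j : ℕ) (hc : c = M * 2 ^ j)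
    (hM : |M| < 2 ^ 3) : IsFloat 3 emin (c * 2 ^ s) :=
  ⟨M, s + j, hM, by omega, by rw [hc, zpow_add₀ (by norm_num : (2 : ℚ) ≠ 0), zpow_natCast]; ring⟩

/-- An INERT pair in the binade `2^s`: from the base rounding `RN_e(cb + ca) = cb` and `ca` a
nonzero float, the pair `(ca·2^s, cb·2^s)` satisfies the replay relation of
`compress_eq_self_of_isChain`. [cite: Shewchuk1997, §2.7 p. 332; BoldoEtAl2023, §2.2] -/
theorem inert3_sc {s : ℤ} (hs : 0 ≤ s) {ca cb : ℚ}
    (hsum : ∀ em : ℤ, em ≤ 0 → roundTiesEven 3 em (cb + ca) = cb)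
    (ha : IsFloat 3 emin (ca * 2 ^ s)) (ha0 : ca ≠ 0) :
    roundTiesEven 3 emin (cb * 2 ^ s + ca * 2 ^ s) = cb * 2 ^ s ∧
      roundTiesEven 3 emin (ca * 2 ^ s) = ca * 2 ^ s ∧ ca * 2 ^ s ≠ 0 :=
  ⟨by rw [← add_mul]; exact rn3_sc he hs hsum, roundTiesEven_eq_self (by norm_num) ha,
    mul_ne_zero ha0 (zpow_ne_zero _ (by norm_num))⟩

end rounding

/-- The six inert junctions of the family, as base roundings: inside a pair block, between pair
blocks, top pair block below the kink, kink or debris top below debris, inside a debris block, and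
below the summit. [cite: BoldoEtAl2023, §2.2] -/
theorem fam3_junctions (em : ℤ) (hem : em ≤ 0) :
    roundTiesEven 3 em (-96 + 5) = -96 ∧ roundTiesEven 3 em (2560 + -96) = 2560 ∧
      roundTiesEven 3 em (-1536 + -96) = -1536 ∧ roundTiesEven 3 em (-14336 + 448) = -14336 ∧
      roundTiesEven 3 em (229376 + -14336) = 229376 ∧
      roundTiesEven 3 em (-20480 + 448) = -20480 := by
  refine ⟨?_, ?_, ?_, ?_, ?_, ?_⟩
  · rw [show (-96 : ℚ) + 5 = -91 by norm_num]; exact rne3_m91 hem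
  · rw [show (2560 : ℚ) + -96 = 2464 by norm_num]; exact rne3_2464 hem
  · rw [show (-1536 : ℚ) + -96 = -1632 by norm_num]; exact rne3_m1632 hem
  · rw [show (-14336 : ℚ) + 448 = -13888 by norm_num]; exact rne3_m13888 hem
  · rw [show (229376 : ℚ) + -14336 = 215040 by norm_num]; exact rne3_215040 hem
  · rw [show (-20480 : ℚ) + 448 = -20032 by norm_num]; exact rne3_m20032 hem

/-- Junction inside a pair block: `RN(−96 + 5) = −96`. [cite: BoldoEtAl2023, §2.2] -/
theorem jn3_pair : ∀ em : ℤ, em ≤ 0 → roundTiesEven 3 em (-96 + 5) = -96 :=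
  fun em hem => (fam3_junctions em hem).1
/-- Junction between consecutive pair blocks: `RN(2560 − 96) = 2560`. [cite: BoldoEtAl2023, §2.2] -/
theorem jn3_pairs : ∀ em : ℤ, em ≤ 0 → roundTiesEven 3 em (2560 + -96) = 2560 :=
  fun em hem => (fam3_junctions em hem).2.1
/-- Junction pair block / kink: `RN(−1536 − 96) = −1536`. [cite: BoldoEtAl2023, §2.2] -/
theorem jn3_kink : ∀ em : ℤ, em ≤ 0 → roundTiesEven 3 em (-1536 + -96) = -1536 :=
  fun em hem => (fam3_junctions em hem).2.2.1
/-- Junction kink / debris block: `RN(−14336 + 448) = −14336`. [cite: BoldoEtAl2023, §2.2] -/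
theorem jn3_debris : ∀ em : ℤ, em ≤ 0 → roundTiesEven 3 em (-14336 + 448) = -14336 :=
  fun em hem => (fam3_junctions em hem).2.2.2.1
/-- Junction inside a debris block: `RN(229376 − 14336) = 229376`. [cite: BoldoEtAl2023, §2.2] -/
theorem jn3_debris' : ∀ em : ℤ, em ≤ 0 → roundTiesEven 3 em (229376 + -14336) = 229376 :=
  fun em hem => (fam3_junctions em hem).2.2.2.2.1
/-- Junction kink / summit: `RN(−20480 + 448) = −20480`. [cite: BoldoEtAl2023, §2.2] -/
theorem jn3_summit : ∀ em : ℤ, em ≤ 0 → roundTiesEven 3 em (-20480 + 448) = -20480 :=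
  fun em hem => (fam3_junctions em hem).2.2.2.2.2

section chains
variable (he : emin ≤ 0)
include he

/-! ### The inert chains below and above the window -/

/-- The pair blocks form a chain continuing into anything chained onto the top block.
[cite: Shewchuk1997, §2.7 p. 332 (COMPRESS)] -/
theorem isChain_pairs3 : ∀ (m : ℕ) (l : List ℚ),
    List.IsChain (fun a b => roundTiesEven 3 emin (b + a) = b ∧ roundTiesEven 3 emin a = a ∧ a ≠ 0)
      (sc (9 * m) [5, -96] ++ l) →
    List.IsChain (fun a b => roundTiesEven 3 emin (b + a) = b ∧ roundTiesEven 3 emin a = a ∧ a ≠ 0)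
      (pairs3 (m + 1) ++ l)
  | 0, l, h => by simpa [pairs3] using h
  | m + 1, l, h => by
    rw [pairs3, List.append_assoc]
    apply isChain_pairs3 m
    simp only [sc_cons, sc_nil, List.cons_append, List.nil_append] at h ⊢
    have hs : (0 : ℤ) ≤ 9 * (m : ℕ) := by positivity
    refine List.IsChain.cons_cons (inert3_sc he hs jn3_pair (isFloat3_sc he hs 5 0 (by norm_num)
      (by norm_num)) (by norm_num)) (List.IsChain.cons_cons ?_ h)
    have e : (5 : ℚ) * 2 ^ (9 * ((m + 1 : ℕ) : ℤ)) = 2560 * 2 ^ (9 * (m : ℕ) : ℤ) := by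
      rw [show (9 * ((m + 1 : ℕ) : ℤ)) = 9 * (m : ℕ) + (9 : ℕ) by push_cast; ring, sc_shift]
      norm_num
    rw [e]
    exact inert3_sc he hs jn3_pairs (isFloat3_sc he hs (-3) 5 (by norm_num) (by norm_num))
      (by norm_num)

/-- Debris blocks and the summit above a kink top `7·2^6·2^s` form a chain.
[cite: Shewchuk1997, §2.7 p. 332 (COMPRESS)] -/
theorem isChain_debris3 : ∀ (n : ℕ) (s : ℤ), 0 ≤ s →
    List.IsChain (fun a b => roundTiesEven 3 emin (b + a) = b ∧ roundTiesEven 3 emin a = a ∧ a ≠ 0)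
      (448 * 2 ^ s :: (debris3 s n ++ [-20480 * (2 : ℚ) ^ (s + 9 * n)]))
  | 0, s, hs => by
    simp only [debris3, List.nil_append, Nat.cast_zero, mul_zero, add_zero]
    exact List.IsChain.cons_cons (inert3_sc he hs jn3_summit (isFloat3_sc he hs 7 6 (by norm_num)
      (by norm_num)) (by norm_num)) (List.isChain_singleton _)
  | n + 1, s, hs => by
    rw [debris3]
    simp only [sc_cons, sc_nil, List.cons_append, List.nil_append]
    refine List.IsChain.cons_cons (inert3_sc he hs jn3_debris (isFloat3_sc he hs 7 6 (by norm_num)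
      (by norm_num)) (by norm_num)) (List.IsChain.cons_cons (inert3_sc he hs jn3_debris'
      (isFloat3_sc he hs (-7) 11 (by norm_num) (by norm_num)) (by norm_num)) ?_)
    have ih := isChain_debris3 n (s + 9) (by omega)
    have e1 : (448 : ℚ) * 2 ^ (s + 9) = 229376 * 2 ^ s := by
      rw [show s + 9 = s + ((9 : ℕ) : ℤ) by norm_num, sc_shift]; norm_num
    have e2 : s + 9 + 9 * (n : ℤ) = s + 9 * ((n + 1 : ℕ) : ℤ) := by push_cast; ring
    rwa [e1, e2] at ih

end chains

/-! ### One pass = the window moves one block down -/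

section passes
variable (he : emin ≤ 0)
include he

/-- The window pass in the binade `2^s` (`s ≥ 0`). [cite: Shewchuk1997, §2.7 p. 332 (COMPRESS)] -/
theorem compress_window3_sc {s : ℤ} (hs : 0 ≤ s) :
    compress (roundTiesEven 3 emin) (sc s [5, -96, -1536, -12288] ++ [229376 * 2 ^ s]) =
      sc s [-3, -24, 448, -14336] ++ [229376 * 2 ^ s] := by
  have h := compress_map_mul_two_zpow 3 emin s [5, -96, -1536, -12288, 229376]
  rw [compress_window3 (em := emin - s) (by linarith)] at h
  simpa [sc] using h

/-- … and its downward sweep ends with the carry `−3·2^s`.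
[cite: Shewchuk1997, §2.7 p. 332 (COMPRESS), Lines 1–9] -/
theorem compressDown_window3_sc {s : ℤ} (hs : 0 ≤ s) :
    (compressDown (roundTiesEven 3 emin) (229376 * 2 ^ s)
      (sc s [5, -96, -1536, -12288]).reverse).2 = -3 * 2 ^ s := by
  have h := compressDown_mul_two_zpow_snd 3 emin s 229376 [-12288, -1536, -96, 5]
  rw [compressDown_window3 (em := emin - s) (by linarith)] at h
  simpa [sc] using h

/-- **One pass**: with `m + 1` pair blocks below the kink, COMPRESS moves the kink one block down
and leaves one more debris block. [cite: Shewchuk1997, §2.7 p. 332 (COMPRESS)] -/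
theorem compress_state3_succ (m n : ℕ) :
    compress (roundTiesEven 3 emin) (state3 (m + 1) n) = state3 m (n + 1) := by
  have h0 : roundTiesEven 3 emin 0 = 0 := fl_zero (isRoundNearest_roundTiesEven (by norm_num))
  have hs : (0 : ℤ) ≤ 9 * (m : ℕ) := by positivity
  set s : ℤ := 9 * (m : ℕ) with hs_def
  -- the state, cut as `low ++ (midrest ++ [M]) ++ high`
  have e9 : (9 * ((m + 1 : ℕ) : ℤ)) = s + (9 : ℕ) := by rw [hs_def]; push_cast; ring
  have etop : (9 * (((m + 1 : ℕ) : ℤ) + n)) = (s + 9) + 9 * (n : ℤ) := by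
    rw [hs_def]; push_cast; ring
  have etop' : (9 * ((m : ℕ) + ((n + 1 : ℕ) : ℤ))) = (s + 9) + 9 * (n : ℤ) := by
    rw [hs_def]; push_cast; ring
  have hstate : state3 (m + 1) n = pairs3 m ++ (sc s [5, -96, -1536, -12288] ++ [229376 * 2 ^ s]) ++
      (debris3 (s + 9) n ++ [-20480 * (2 : ℚ) ^ ((s + 9) + 9 * n)]) := by
    simp only [state3, pairs3, kink3, e9, etop, ← hs_def, sc_shift, sc_cons, sc_nil,
      List.append_assoc, List.cons_append, List.nil_append]
    norm_num
  have hstate' : state3 m (n + 1) = pairs3 m ++ (sc s [-3, -24, 448, -14336] ++ [229376 * 2 ^ s]) ++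
      (debris3 (s + 9) n ++ [-20480 * (2 : ℚ) ^ ((s + 9) + 9 * n)]) := by
    simp only [state3, kink3, debris3, etop', ← hs_def, sc_cons, sc_nil, List.append_assoc,
      List.cons_append, List.nil_append]
  -- below: the pair blocks, inert against the new kink bottom `−3·2^s`
  have hlow : List.IsChain
      (fun a b => roundTiesEven 3 emin (b + a) = b ∧ roundTiesEven 3 emin a = a ∧ a ≠ 0)
      (pairs3 m ++ [(compressDown (roundTiesEven 3 emin) (229376 * 2 ^ s)
        (sc s [5, -96, -1536, -12288]).reverse).2]) := by
    rw [compressDown_window3_sc he hs]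
    cases m with
    | zero => simp [pairs3]
    | succ m' =>
      apply isChain_pairs3 he m'
      have hs' : (0 : ℤ) ≤ 9 * (m' : ℕ) := by positivity
      have e : (-3 : ℚ) * 2 ^ s = -1536 * 2 ^ (9 * (m' : ℕ) : ℤ) := by
        rw [hs_def, show (9 * ((m' + 1 : ℕ) : ℤ)) = 9 * (m' : ℕ) + (9 : ℕ) by push_cast; ring,
          sc_shift]; norm_num
      simp only [sc_cons, sc_nil, List.cons_append, List.nil_append, e]
      exact List.IsChain.cons_cons (inert3_sc he hs' jn3_pair (isFloat3_sc he hs' 5 0 (by norm_num)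
        (by norm_num)) (by norm_num)) (List.IsChain.cons_cons (inert3_sc he hs' jn3_kink
        (isFloat3_sc he hs' (-3) 5 (by norm_num) (by norm_num)) (by norm_num))
        (List.isChain_singleton _))
  -- above: debris and summit, inert against the window top `7·2^15·2^s = 7·2^6·2^(s+9)`
  have hhigh : List.IsChain
      (fun a b => roundTiesEven 3 emin (b + a) = b ∧ roundTiesEven 3 emin a = a ∧ a ≠ 0)
      (229376 * 2 ^ s :: (debris3 (s + 9) n ++ [-20480 * (2 : ℚ) ^ ((s + 9) + 9 * n)])) := by
    have ih := isChain_debris3 he n (s + 9) (by omega)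
    have e1 : (448 : ℚ) * 2 ^ (s + 9) = 229376 * 2 ^ s := by
      rw [show s + 9 = s + ((9 : ℕ) : ℤ) by norm_num, sc_shift]; norm_num
    rwa [e1] at ih
  rw [hstate, compress_append3_of_isChain h0 hlow (compress_window3_sc he hs) hhigh hhigh,
    compress_window3_sc he hs, hstate']

/-- **The last pass**: with the kink at the bottom, COMPRESS turns `⟨−3, −3·2^3, 7·2^6⟩` into
`⟨1, −7·2^2, 7·2^6⟩`. [cite: Shewchuk1997, §2.7 p. 332 (COMPRESS)] -/
theorem compress_state3_zero (n : ℕ) :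
    compress (roundTiesEven 3 emin) (state3 0 n) = final3 n := by
  have h0 : roundTiesEven 3 emin 0 = 0 := fl_zero (isRoundNearest_roundTiesEven (by norm_num))
  have hhigh := isChain_debris3 he n 0 le_rfl
  simp only [zpow_zero, mul_one, zero_add] at hhigh
  have hst : state3 0 n =
      ([-3, -24] ++ [448]) ++ (debris3 0 n ++ [-20480 * (2 : ℚ) ^ (9 * (n : ℤ))]) := by
    simp [state3, pairs3, kink3]
  have hys : compress (roundTiesEven 3 emin) ([-3, -24] ++ [448]) = [1, -28] ++ [448] := by
    simpa using compress_kink3 he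
  rw [hst, compress_append_of_isChain_right h0 hys hhigh hhigh, hys]
  simp [final3]

/-- … and the result is fixed. [cite: Shewchuk1997, §2.7 p. 332 (COMPRESS)] -/
theorem compress_final3 (n : ℕ) : compress (roundTiesEven 3 emin) (final3 n) = final3 n := by
  have h0 : roundTiesEven 3 emin 0 = 0 := fl_zero (isRoundNearest_roundTiesEven (by norm_num))
  have hhigh := isChain_debris3 he n 0 le_rfl
  simp only [zpow_zero, mul_one, zero_add] at hhigh
  have hst : final3 n =
      ([1, -28] ++ [448]) ++ (debris3 0 n ++ [-20480 * (2 : ℚ) ^ (9 * (n : ℤ))]) := by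
    simp [final3]
  have hys : compress (roundTiesEven 3 emin) ([1, -28] ++ [448]) = [1, -28] ++ [448] := by
    simpa using compress_kink3_final he
  rw [hst, compress_append_of_isChain_right h0 hys hhigh hhigh, hys]

end passes

end Summit.Ventures.CertifiedArithmetic.Expansions
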